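import Literature.NumberTheory.Automorphic.HyperspecialUnitaryCartanFrames
import Literature.NumberTheory.Automorphic.HermitianLatticesAdaptedPlaneTame
import HarnessLib

/-!
# Cartan decomposition of the quasi-split unitary group `U(σ, J₀)(K)`, `J₀ = antidiag(1,…,1)`, for ANY uniformiser —
# I: the frame induction (unramified and TAMELY RAMIFIED quadratic `K/K^σ` alike; Tits 1979 §3.3.3; Bruhat–Tits 1972 (4.4.3))

Topic `NumberTheory/Automorphic`; namespace `Literature.NumberTheory.Automorphic.HermitianLattice`.
THEOREMS only; no definition, no instance, no notation, no named fact, no `sorry`.  Sequel of ★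
`HyperspecialUnitaryCartanFrames` (the same statement under ★ `UnramifiedLocalConjDatum σ ϖ`, i.e. with a `σ`-FIXED
uniformiser) and of `HermitianLatticesAdaptedPlaneTame` (the adapted plane for any uniformiser).

Setting: `K` with `Valued K ℤᵐ⁰`; the five bare hypotheses `hσ : σ ∘ σ = id`, `hvσ : v ∘ σ = v`, `hϖ : v ϖ = exp (-1)`
(ANY uniformiser), (trace) `htrace`, (norm) `hnorm` — valid at the unramified places (fields of ★ `UnramifiedLocalConjDatum`)
and at the tamely ramified places of a quadratic extension of non-archimedean local fields; the split Hermitian space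
`(K^N, B₀)`, `B₀ x y = ∑ σ(x i) y (rev i)` (★ `UnitaryAntidiagFrames`), its standard lattice `𝒪^N`, frames `K^S`, `𝒪^S`.

* **`exists_frame_cartan_of_trace_norm`** — the inductive statement over `rev`-closed frames `S ⊆ Fin N`: every unimodular
  lattice `M` in `K^S` is `ψ(t_d 𝒪^S)` for a `B₀`-isometry `ψ` of `K^N` with `ψ(𝒪^N) = 𝒪^N` fixing the `e i`, `i ∉ S`, and a
  diagonal `t_d = diag(d)` with **`σ(d i) · d (rev i) = 1`** (the torus of `U(σ, J₀)`; at an unramified place one may take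
  `σ d = d`, ★ file) and `d = 1` off `S`.  Step: an adapted hyperbolic pair `x, y ∈ 𝒪^S` for `(𝒪^S, M)`
  (`exists_adapted_hyperbolicPair_of_trace_norm`), normalised at a unit coordinate `i₀` (★ `exists_unit_coord`); two unitary
  transvections (★ `UnitaryAntidiagTransvections`) give `φ ∈ U(J₀)(𝒪)` supported on `S` with `φ e i₀ = x`, `φ e (rev i₀) = y`;
  then `φ⁻¹ M = (𝒪 ϖ^{-a} e i₀ ⊕ 𝒪 σ(ϖ^{a}) e (rev i₀)) ⊕ M'` — the split-off plane is `(P⁻¹ e_{i₀}, σ(P) e_{rev i₀})`,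
  hyperbolic for ANY `P ≠ 0` (★ `IsHyperbolicPair.smul_unit`), and `σ(P) y ∈ M` since `σ P ∈ P𝒪` — with `M'` unimodular in
  `K^{S ∖ {i₀, rev i₀}}` (★ `IsUnimodularLattice.restrict`), and induction.
The matrix form (`U(σ, J₀)(K) = K₀ T K₀`, `K₀ = U ∩ GL_N(𝒪)`) is in `QuasiSplitUnitaryCartanTame`.

References: J. Tits, *Reductive groups over local fields*, PSPUM 33.1 (1979), §3.3.3 (`G = K Λ⁺ K` for special `K`) [Tits1979];
F. Bruhat, J. Tits, *Groupes réductifs sur un corps local I*, Publ. IHÉS 41 (1972), (4.4.3) [BruhatTits1972];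
R. Jacobowitz, *Hermitian forms over local fields*, Amer. J. Math. 84 (1962), §§7–8 [Jacobowitz1962];
O. T. O'Meara, *Introduction to Quadratic Forms* (1963), §42D, §81A, §82F [Omeara1963].
-/

noncomputable section

open scoped Valued WithZero Matrix

namespace Literature.NumberTheory.Automorphic.HermitianLattice

variable {K : Type*} [Field K] [Valued K ℤᵐ⁰] {σ : K →+* K} {ϖ : K} {N : ℕ}

/-! ## The frame induction for any uniformiser -/

/-- **The frame induction — any uniformiser, (trace) + (norm)** (the unramified and the tamely ramified quadratic case alike;
hypotheses as in ★ `exists_adapted_hyperbolicPair_of_trace_norm`): every unimodular lattice `M` in `K^S` (`S` a `rev`-closed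
frame) is `ψ(t_d 𝒪^S)` for a `B₀`-isometry `ψ` of `K^N` with `ψ(𝒪^N) = 𝒪^N` fixing the `e i`, `i ∉ S`, and a diagonal
`t_d = diag(d) ∈ U(σ, J₀)`, i.e. `σ(d i) · d (rev i) = 1`, with `d = 1` off `S`.  Proof = ★
`UnramifiedLocalConjDatum.exists_frame_cartan` with the split-off plane `(P⁻¹ e_{i₀}, σ(P) e_{rev i₀})`, `P = ϖ^a`
(★ `IsHyperbolicPair.smul_unit`; `σ P • y' ∈ M` because `σ P = w P` with `v w ≤ 1`), so the new diagonal entries are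
`d i₀ = P⁻¹`, `d (rev i₀) = σ P`. [cite: Tits1979, §3.3.3] [cite: BruhatTits1972, (4.4.3)] [cite: Jacobowitz1962, §§7–8] -/
theorem exists_frame_cartan_of_trace_norm (hσ : ∀ x, σ (σ x) = x) (hvσ : ∀ x, Valued.v (σ x) = Valued.v x)
    (hϖ : Valued.v ϖ = WithZero.exp (-1 : ℤ)) (htrace : ∃ t : K, Valued.v t ≤ 1 ∧ t + σ t = 1)
    (hnorm : ∀ u : K, σ u = u → Valued.v (u - 1) < 1 → ∃ z : K, z * σ z = u ∧ Valued.v (z - 1) ≤ Valued.v (u - 1))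
    (S : Finset (Fin N)) (hS : ∀ i ∈ S, Fin.rev i ∈ S)
    (M : Submodule 𝒪[K] (Fin N → K)) (hM : IsUnimodularLattice (B₀ σ N) (frame K N S) M) :
    ∃ (ψ : (Fin N → K) ≃ₗ[K] (Fin N → K)) (d : Fin N → K),
      (∀ u v, B₀ σ N (ψ u) (ψ v) = B₀ σ N u v) ∧
      (∀ i, i ∉ S → ψ (Pi.single i 1) = Pi.single i 1) ∧
      (stdLattice K N).map (ψ.toLinearMap.restrictScalars 𝒪[K]) = stdLattice K N ∧
      (∀ i, σ (d i) * d (Fin.rev i) = 1) ∧ (∀ i, i ∉ S → d i = 1) ∧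
      M = ((frameLattice K N S).map ((Matrix.toLin' (Matrix.diagonal d)).restrictScalars 𝒪[K])).map
            (ψ.toLinearMap.restrictScalars 𝒪[K]) := by
  have hB : IsHermitianForm (B₀ σ N) := isHermitianForm_B₀ hσ
  induction S using Finset.strongInduction generalizing M with
  | H S ih =>
  have hL := isUnimodularLattice_frameLattice (N := N) hvσ hS
  by_cases hML : M ≤ frameLattice K N S
  · -- `M = 𝒪^S`: identity and `d = 1`
    have hEq : M = frameLattice K N S := hL.eq_of_le hM hML
    refine ⟨LinearEquiv.refl K _, fun _ => 1, fun u v => rfl, fun i _ => rfl, ?_,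
      fun _ => by rw [map_one, mul_one], fun _ _ => rfl, ?_⟩
    · rw [restrictScalars_refl, Submodule.map_id]
    · rw [hEq, Matrix.diagonal_one, Matrix.toLin'_one, restrictScalars_id, Submodule.map_id, restrictScalars_refl,
        Submodule.map_id]
  · -- an adapted hyperbolic pair, normalised at a unit coordinate `i₀`
    obtain ⟨a, x, y, ha, hp, hxL, hyL, hxM, hyM⟩ := exists_adapted_hyperbolicPair_of_trace_norm hσ hvσ hϖ htrace hnorm hB hL hM hML
    obtain ⟨i₀, hi₀S, hi₀, hunit⟩ := exists_unit_coord hvσ hxL hyL hp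
    have hi₁S : Fin.rev i₀ ∈ S := hS i₀ hi₀S
    have hi₁' : Fin.rev (Fin.rev i₀) ≠ Fin.rev i₀ := by rw [Fin.rev_rev]; exact hi₀.symm
    have hne : i₀ ≠ Fin.rev i₀ := fun h => hi₀ h.symm
    -- the scalar `P = ϖ^a`; `σ P = w · P` with a unit `w` (no `σ ϖ = ϖ` needed)
    have hϖ0 : ϖ ≠ 0 := fun h0 => by
      rw [h0, map_zero] at hϖ
      exact WithZero.coe_ne_zero hϖ.symm
    have hP0 : ϖ ^ a ≠ 0 := pow_ne_zero _ hϖ0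
    obtain ⟨P, hPdef⟩ : ∃ P : K, ϖ ^ a = P := ⟨_, rfl⟩
    rw [hPdef] at hP0 hxM hyM
    have hσP0 : σ P ≠ 0 := (map_ne_zero σ).2 hP0
    have hvw : Valued.v (σ P / P) ≤ 1 := by
      rw [map_div₀, hvσ, div_self ((Valuation.ne_zero_iff _).2 hP0)]
    have hσPw : σ P = σ P / P * P := (div_mul_cancel₀ _ hP0).symm
    -- rescale: `x' = t⁻¹ x`, `y' = σ t y`, `t = x i₀`
    have ht0 : x i₀ ≠ 0 := fun h => by rw [h, map_zero] at hunit; exact zero_ne_one hunit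
    have hvt' : Valued.v (x i₀)⁻¹ ≤ 1 := by rw [map_inv₀, hunit, inv_one]
    have hvσt : Valued.v (σ (x i₀)) ≤ 1 := by rw [hvσ, hunit]
    obtain ⟨x', hx'⟩ : ∃ x' : Fin N → K, (x i₀)⁻¹ • x = x' := ⟨_, rfl⟩
    obtain ⟨y', hy'⟩ : ∃ y' : Fin N → K, σ (x i₀) • y = y' := ⟨_, rfl⟩
    have hp' : IsHyperbolicPair (B₀ σ N) x' y' := hx' ▸ hy' ▸ hp.smul_unit ht0
    have hx'L : x' ∈ frameLattice K N S := hx' ▸ smul_mem_of_v_le _ hvt' hxL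
    have hy'L : y' ∈ frameLattice K N S := hy' ▸ smul_mem_of_v_le _ hvσt hyL
    have hx'M : P⁻¹ • x' ∈ M := by rw [← hx', smul_comm]; exact smul_mem_of_v_le _ hvt' hxM
    have hy'M : P • y' ∈ M := by rw [← hy', smul_comm]; exact smul_mem_of_v_le _ hvσt hyM
    have hσy'M : σ P • y' ∈ M := by rw [hσPw, ← smul_smul]; exact smul_mem_of_v_le _ hvw hy'M
    have hx'1 : x' i₀ = 1 := by rw [← hx', Pi.smul_apply, smul_eq_mul, inv_mul_cancel₀ ht0]
    have hx'0 : B₀ σ N x' x' = 0 := hp'.left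
    obtain ⟨hx'int, hx'S⟩ := mem_frameLattice.1 hx'L
    obtain ⟨hy'int, hy'S⟩ := mem_frameLattice.1 hy'L
    -- first transvection `τ₁ : e i₀ ↦ x'`; `y'' := τ₁⁻¹ y'`
    set τ₁ := transvEquiv hσ hi₀ hx'1 hx'0 with hτ₁
    obtain ⟨y'', hy''⟩ : ∃ y'' : Fin N → K, τ₁.symm y' = y'' := ⟨_, rfl⟩
    have hτ₁y'' : τ₁ y'' = y' := by rw [← hy'', LinearEquiv.apply_symm_apply]
    have hy''1 : y'' (Fin.rev i₀) = 1 := by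
      have h := B₀_transv hσ hi₀ hx'1 hx'0 (Pi.single i₀ 1) y''
      rw [transv_single_self hi₀, ← transvEquiv_apply hσ hi₀ hx'1 hx'0, hτ₁y'', hp'.pair, B₀_single_left] at h
      exact h.symm
    have hy''0 : B₀ σ N y'' y'' = 0 := by
      have h := B₀_transv hσ hi₀ hx'1 hx'0 y'' y''
      rw [← transvEquiv_apply hσ hi₀ hx'1 hx'0, hτ₁y'', hp'.right] at h
      exact h.symm
    have hy''int : y'' ∈ stdLattice K N :=
      hy'' ▸ transv_mem_stdLattice hvσ (transvDual_mem_stdLattice hi₀ hvσ hx'int) hy'int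
    have hy''S : y'' ∈ frame K N S :=
      hy'' ▸ transv_mem_frame hi₀S hi₁S (transvDual_mem_frame hi₀S hi₁S hx'S) hy'S
    -- second transvection `τ₂ : e (rev i₀) ↦ y''` (it fixes `e i₀`); `φ := τ₁ ∘ τ₂`
    set τ₂ := transvEquiv hσ hi₁' hy''1 hy''0 with hτ₂
    set φ := τ₂.trans τ₁ with hφ
    have hφapply : ∀ z, φ z = transv σ N i₀ x' (transv σ N (Fin.rev i₀) y'' z) := fun z => rfl
    have hφiso : ∀ u v, B₀ σ N (φ u) (φ v) = B₀ σ N u v := fun u v => by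
      rw [hφapply, hφapply, B₀_transv hσ hi₀ hx'1 hx'0, B₀_transv hσ hi₁' hy''1 hy''0]
    have hφe₀ : φ (Pi.single i₀ 1) = x' := by
      have h1 : transv σ N (Fin.rev i₀) y'' (Pi.single i₀ 1) = Pi.single i₀ 1 := by
        have h := transv_single_rev (σ := σ) hi₁' hy''1
        rwa [Fin.rev_rev] at h
      rw [hφapply, h1, transv_single_self hi₀]
    have hφe₁ : φ (Pi.single (Fin.rev i₀) 1) = y' := by
      rw [hφapply, transv_single_self hi₁', ← hτ₁y'']; rfl
    have hφfix : ∀ k, k ∉ S → φ (Pi.single k 1) = Pi.single k 1 := by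
      intro k hk
      have hk0 : k ≠ i₀ := fun h => hk (h ▸ hi₀S)
      have hk1 : k ≠ Fin.rev i₀ := fun h => hk (h ▸ hi₁S)
      have hkr : Fin.rev k ∉ S := fun h => hk (by simpa using hS _ h)
      rw [hφapply, transv_single_of_eq_zero hk1 (by rw [Fin.rev_rev]; exact hk0) (hy''S _ hkr),
        transv_single_of_eq_zero hk0 hk1 (hx'S _ hkr)]
    have hφstd : (stdLattice K N).map (φ.toLinearMap.restrictScalars 𝒪[K]) = stdLattice K N := by
      rw [hφ, map_trans, map_transvEquiv_stdLattice hσ hi₁' hy''1 hy''0 hvσ hy''int,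
        map_transvEquiv_stdLattice hσ hi₀ hx'1 hx'0 hvσ hx'int]
    have hφframe : (frame K N S).map φ.toLinearMap = frame K N S := by
      rw [hφ, map_trans', map_transvEquiv_frame hσ hi₁' hy''1 hy''0 hi₁S (by rw [Fin.rev_rev]; exact hi₀S) hy''S,
        map_transvEquiv_frame hσ hi₀ hx'1 hx'0 hi₀S hi₁S hx'S]
    -- transport `M` along `φ⁻¹`
    have hφsymm_iso : ∀ u v, B₀ σ N (φ.symm u) (φ.symm v) = B₀ σ N u v := fun u v => by
      conv_rhs => rw [← φ.apply_symm_apply u, ← φ.apply_symm_apply v]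
      exact (hφiso _ _).symm
    have hM₁ : IsUnimodularLattice (B₀ σ N) (frame K N S) (M.map (φ.symm.toLinearMap.restrictScalars 𝒪[K])) := by
      have h := hM.map_equiv' φ.symm hφsymm_iso
      rwa [map_symm_eq_self hφframe] at h
    have he₀ : φ.symm x' = Pi.single i₀ 1 := by rw [← hφe₀, LinearEquiv.symm_apply_apply]
    have he₁ : φ.symm y' = Pi.single (Fin.rev i₀) 1 := by rw [← hφe₁, LinearEquiv.symm_apply_apply]
    have he₀M₁ : P⁻¹ • (Pi.single i₀ 1 : Fin N → K) ∈ M.map (φ.symm.toLinearMap.restrictScalars 𝒪[K]) :=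
      ⟨P⁻¹ • x', hx'M, by rw [LinearMap.coe_restrictScalars, LinearEquiv.coe_coe, map_smul, he₀]⟩
    have he₁M₁ : σ P • (Pi.single (Fin.rev i₀) 1 : Fin N → K) ∈ M.map (φ.symm.toLinearMap.restrictScalars 𝒪[K]) :=
      ⟨σ P • y', hσy'M, by rw [LinearMap.coe_restrictScalars, LinearEquiv.coe_coe, map_smul, he₁]⟩
    -- split off the standard plane and restrict to the frame `S' = S ∖ {i₀, rev i₀}`
    have hpair : IsHyperbolicPair (B₀ σ N) (P⁻¹ • (Pi.single i₀ 1 : Fin N → K)) (σ P • Pi.single (Fin.rev i₀) 1) :=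
      (isHyperbolicPair_single hi₀).smul_unit hP0
    obtain ⟨hM₁', hM₁dec⟩ := hM₁.restrict hB hpair he₀M₁ he₁M₁
    rw [orth_smul (inv_ne_zero hP0) hσP0, frame_inf_orth_single, orthInt_smul (inv_ne_zero hP0) hσP0] at hM₁'
    rw [orthInt_smul (inv_ne_zero hP0) hσP0] at hM₁dec
    have hsub : (S.erase i₀).erase (Fin.rev i₀) ⊂ S :=
      (Finset.erase_subset _ _).trans_ssubset (Finset.erase_ssubset hi₀S)
    have hS'rev : ∀ i ∈ (S.erase i₀).erase (Fin.rev i₀), Fin.rev i ∈ (S.erase i₀).erase (Fin.rev i₀) := by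
      intro i hi
      simp only [Finset.mem_erase] at hi ⊢
      obtain ⟨hi1, hi2, hi3⟩ := hi
      exact ⟨fun h => hi2 (Fin.rev_injective h), fun h => hi1 (by rw [← h, Fin.rev_rev]), hS i hi3⟩
    have hi₀S' : i₀ ∉ (S.erase i₀).erase (Fin.rev i₀) := by simp
    have hi₁S' : Fin.rev i₀ ∉ (S.erase i₀).erase (Fin.rev i₀) := by simp
    obtain ⟨ψ', d', hψ'iso, hψ'fix, hψ'L, hd'inv, hd'1, hM₁'eq⟩ := ih _ hsub hS'rev _ hM₁'
    -- the new diagonal: `P⁻¹` at `i₀`, `σ P` at `rev i₀`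
    obtain ⟨d, hd⟩ : ∃ d : Fin N → K, Function.update (Function.update d' i₀ P⁻¹) (Fin.rev i₀) (σ P) = d := ⟨_, rfl⟩
    have hd₁ : d (Fin.rev i₀) = σ P := by rw [← hd, Function.update_self]
    have hd₀ : d i₀ = P⁻¹ := by rw [← hd, Function.update_of_ne hne, Function.update_self]
    have hd'' : ∀ k, k ≠ i₀ → k ≠ Fin.rev i₀ → d k = d' k := fun k hk0 hk1 => by
      rw [← hd, Function.update_of_ne hk1, Function.update_of_ne hk0]
    have hagree : ∀ z ∈ frameLattice K N ((S.erase i₀).erase (Fin.rev i₀)),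
        Matrix.toLin' (Matrix.diagonal d) z = Matrix.toLin' (Matrix.diagonal d') z := by
      intro z hz
      obtain ⟨-, hzS⟩ := mem_frameLattice.1 hz
      ext k
      rw [Matrix.toLin'_apply, Matrix.toLin'_apply, Matrix.mulVec_diagonal, Matrix.mulVec_diagonal]
      by_cases hk0 : k = i₀
      · rw [hk0, hzS _ hi₀S', mul_zero, mul_zero]
      by_cases hk1 : k = Fin.rev i₀
      · rw [hk1, hzS _ hi₁S', mul_zero, mul_zero]
      · rw [hd'' k hk0 hk1]
    refine ⟨ψ'.trans φ, d, ?_, ?_, ?_, ?_, ?_, ?_⟩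
    · intro u v
      change B₀ σ N (φ (ψ' u)) (φ (ψ' v)) = _
      rw [hφiso, hψ'iso]
    · intro k hk
      change φ (ψ' (Pi.single k 1)) = _
      rw [hψ'fix k (fun h => hk (hsub.subset h)), hφfix k hk]
    · rw [map_trans, hψ'L, hφstd]
    · intro k
      by_cases hk0 : k = i₀
      · rw [hk0, hd₀, hd₁, map_inv₀, inv_mul_cancel₀ hσP0]
      by_cases hk1 : k = Fin.rev i₀
      · rw [hk1, hd₁, Fin.rev_rev, hd₀, hσ, mul_inv_cancel₀ hP0]
      · rw [hd'' k hk0 hk1, hd'' (Fin.rev k) (fun h => hk1 (by rw [← h, Fin.rev_rev]))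
          (fun h => hk0 (Fin.rev_injective h)), hd'inv]
    · intro k hk
      have hk0 : k ≠ i₀ := fun h => hk (h ▸ hi₀S)
      have hk1 : k ≠ Fin.rev i₀ := fun h => hk (h ▸ hi₁S)
      rw [hd'' k hk0 hk1, hd'1 k (fun h => hk (hsub.subset h))]
    · -- the lattice identity `M = ψ (t_d 𝒪^S)`
      obtain ⟨-, hLdec⟩ := hL.restrict hB (isHyperbolicPair_single hi₀)
        (mem_frameLattice.2 ⟨single_mem_stdLattice i₀, single_mem_frame hi₀S⟩)
        (mem_frameLattice.2 ⟨single_mem_stdLattice _, single_mem_frame hi₁S⟩)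
      rw [frameLattice_inf_orthInt_single] at hLdec
      have h1 : (frameLattice K N S).map ((Matrix.toLin' (Matrix.diagonal d)).restrictScalars 𝒪[K]) =
          Submodule.span 𝒪[K] {P⁻¹ • (Pi.single i₀ 1 : Fin N → K), σ P • Pi.single (Fin.rev i₀) 1} ⊔
            (frameLattice K N ((S.erase i₀).erase (Fin.rev i₀))).map
              ((Matrix.toLin' (Matrix.diagonal d')).restrictScalars 𝒪[K]) := by
        rw [hLdec, Submodule.map_sup, map_span_pair, toLin'_diagonal_single, toLin'_diagonal_single, hd₀, hd₁,
          map_eq_map_of_eqOn hagree]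
      have h2 : (Submodule.span 𝒪[K] {P⁻¹ • (Pi.single i₀ 1 : Fin N → K), σ P • Pi.single (Fin.rev i₀) 1} ⊔
            (frameLattice K N ((S.erase i₀).erase (Fin.rev i₀))).map
              ((Matrix.toLin' (Matrix.diagonal d')).restrictScalars 𝒪[K])).map
              (ψ'.toLinearMap.restrictScalars 𝒪[K]) = M.map (φ.symm.toLinearMap.restrictScalars 𝒪[K]) := by
        rw [Submodule.map_sup, map_span_pair, ← hM₁'eq, LinearEquiv.coe_coe, map_smul, map_smul,
          hψ'fix _ hi₀S', hψ'fix _ hi₁S']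
        exact hM₁dec.symm
      rw [map_trans, h1, h2, map_symm_map]

end Literature.NumberTheory.Automorphic.HermitianLattice

end
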